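import Literature.Algebra.Homology.MapBifunctorQuasiIso
import Literature.AlgebraicGeometry.Modules.BoxTensorExactRight
import Literature.AlgebraicGeometry.Modules.StrictlyPerfectResolution
import Mathlib.Algebra.Homology.DerivedCategory.Basic
import HarnessLib

/-!
# The box of two strictly perfect resolutions resolves the box of the modules (Tor-independent case):
# `R• ⊠ S• → (G ⊠ H)[0]` is a quasi-isomorphism, `Q(R• ⊠ S•) ≅ Q((G ⊠ H)[0])`

Layer `Literature/AlgebraicGeometry/Modules` (0 named facts, no instances). For a span of schemes `p : Z ⟶ X`, `q : Z ⟶ Y`, modules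
`G` on `X`, `H` on `Y` with strictly perfect resolutions `R : StrictlyPerfectResolution G`, `S : StrictlyPerfectResolution H`
(`Modules/StrictlyPerfectResolution`), and the external tensor product of complexes `R.P ⊠ S.P = boxTensorComplex p q R.P S.P`
(`Modules/BoxTensor`, Mathlib `mapBifunctor` of `boxTensorFunctor p q : M ↦ N ↦ p^*M ⊗ q^*N`), ASSUME

* `p^*` is left exact (`[PreservesFiniteLimits (Scheme.Modules.pullback p)]`, e.g. `p` flat), so that the rows `M ↦ M ⊠ Sʲ` are exact
  (`Modules/BoxTensorExactRight.preservesHomology_boxTensorFunctor_flip_obj`, `Sʲ` finite locally free), and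
* `E_G := (boxTensorFunctor p q).obj G : N ↦ p^*G ⊗ q^*N` is exact (`[PreservesFiniteLimits E_G] [PreservesFiniteColimits E_G]`) — the
  TOR-INDEPENDENCE input; over a field it is discharged by `Modules/BoxTensorExact.preservesFiniteLimits_boxLeftFunctor`
  (`E_G = boxLeftFunctor p q G` by `rfl`) at any cartesian square `IsPullback p q X.hom Y.hom` over `Spec k`.

THEN (everything proved):
* `quasiIso_boxTensorComplexMap_ε_left : QuasiIso (R.ε ⊠ 𝟙_{S•} : R• ⊠ S• ⟶ G[0] ⊠ S•)` — rows, by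
  `Literature/Algebra/Homology/MapBifunctorQuasiIso.quasiIso_mapBifunctorMap_id_right` (bounded `S•` in the second variable);
* `quasiIso_boxTensorComplexMap_ε_right : QuasiIso (𝟙_{G[0]} ⊠ S.ε : G[0] ⊠ S• ⟶ G[0] ⊠ H[0])` — the exact column functor `E_G`
  (`MapBifunctorSingleColumn.quasiIso_mapBifunctorMap_single₀`);
* `boxTensorComplexSingleIso : G[0] ⊠ H[0] ≅ (G ⊠ H)[0]` (column isomorphism + Mathlib `singleMapHomologicalComplex`);
* `boxTensorComplexAugmentation R S : R• ⊠ S• ⟶ (G ⊠ H)[0]`, `quasiIso_boxTensorComplexAugmentation`, and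
  **`nonempty_Q_boxTensorComplex_iso_single : Nonempty (Q (R• ⊠ S•) ≅ Q ((G ⊠ H)[0]))`** in the derived category.

This is Stacks 0FXX/08II «`K ⊠ M = Lp^*K ⊗^L Lq^*M`» computed by strictly perfect resolutions when `X`, `Y` are Tor-independent over
the base (Stacks 0FXZ hypothesis), in the tree's language. Use: cell `pub-hodge-ring2`, crux 26512, lane [BOX-RES] — it feeds the
input `eRes` of `Theorems/VHCAbelianSchemesRoadBoxIsoOfThetaBoxPresentation.e₂_of_boxResolutionsIso` (research route conditional on
HC_CM; not a corollary — nothing here refers to it).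

## References

* The Stacks Project, Tag 0FXX and Lemma 0FXZ (`K ⊠ M`, Tor-independence), Tag 08II, Tag 0133 (double complexes). [StacksProject]
* C. A. Weibel, *An introduction to homological algebra* (1994), 2.7.1–2.7.3, Thm. 5.6.4 context (tensor product of resolutions), 10.4. [Weibel1994]
* R. Hartshorne, *Algebraic Geometry* (1977), III Prop. 9.2 (flat pull-back is exact), III Ex. 6.5, 6.9 (locally free resolutions). [Hartshorne1977]
-/

noncomputable section

-- `TopCat.Presheaf`/`Scheme.Modules`/`GradedObject` are not reducible (as in Mathlib's `AlgebraicGeometry/Modules`).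
set_option backward.isDefEq.respectTransparency false

open CategoryTheory CategoryTheory.Category CategoryTheory.Limits AlgebraicGeometry HomologicalComplex

universe w u

namespace Literature.AlgebraicGeometry.Modules

open Literature.AlgebraicGeometry.Motives Literature.Algebra.Homology

variable {X Y Z : Scheme.{u}} (p : Z ⟶ X) (q : Z ⟶ Y)

/-! ### §1 Additivity of `⊠` in each variable (theorems, bind with `haveI`) -/

/-- `M ↦ M ⊠ –` is additive (`(f + g) ⊠ 𝟙 = f ⊠ 𝟙 + g ⊠ 𝟙`). [cite: StacksProject, Tag 0FXX] -/
theorem additive_boxTensorFunctor : (boxTensorFunctor p q).Additive :=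
  ⟨fun {_ _} {f g} => NatTrans.ext (funext fun N =>
    (haveI := additive_boxTensorFunctor_flip_obj p q N; ((boxTensorFunctor p q).flip.obj N).map_add :
      ((boxTensorFunctor p q).flip.obj N).map (f + g) = _))⟩

/-- `N ↦ M ⊠ N = q^* ⋙ (p^*M ⊗ –)` is additive. [cite: StacksProject, Tag 0FXX] -/
theorem additive_boxTensorFunctor_obj (M : X.Modules) : ((boxTensorFunctor p q).obj M).Additive :=
  haveI := additive_tensorBifunctor_obj (X := Z) ((Scheme.Modules.pullback p).obj M)
  inferInstanceAs (Scheme.Modules.pullback q ⋙ (tensorBifunctor Z).obj ((Scheme.Modules.pullback p).obj M)).Additive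

/-- The flipped bifunctor `N ↦ M ↦ M ⊠ N` is additive. [cite: StacksProject, Tag 0FXX] -/
theorem additive_boxTensorFunctor_flip : (boxTensorFunctor p q).flip.Additive :=
  ⟨fun {_ _} {f g} => NatTrans.ext (funext fun M =>
    (haveI := additive_boxTensorFunctor_obj p q M; ((boxTensorFunctor p q).obj M).map_add :
      ((boxTensorFunctor p q).obj M).map (f + g) = _))⟩

/-! ### §2 Morphisms of boxes of complexes -/

section Map

variable {K K' : CochainComplex X.Modules ℤ} {L L' : CochainComplex Y.Modules ℤ}

/-- `f ⊠ g : K ⊠ L ⟶ K' ⊠ L'` for morphisms of complexes (Mathlib `mapBifunctorMap`). [cite: StacksProject, Tag 0FXX] -/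
def boxTensorComplexMap (f : K ⟶ K') (g : L ⟶ L') : boxTensorComplex p q K L ⟶ boxTensorComplex p q K' L' :=
  haveI := preservesZeroMorphisms_boxTensorFunctor p q
  haveI := preservesZeroMorphisms_boxTensorFunctor_obj p q
  mapBifunctorMap f g (boxTensorFunctor p q) (ComplexShape.up ℤ)

/-- `boxTensorComplexMap` IS Mathlib's `mapBifunctorMap` (`rfl`). [cite: StacksProject, Tag 0FXX] -/
theorem boxTensorComplexMap_eq (f : K ⟶ K') (g : L ⟶ L') :
    haveI := preservesZeroMorphisms_boxTensorFunctor p q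
    haveI := preservesZeroMorphisms_boxTensorFunctor_obj p q
    boxTensorComplexMap p q f g = mapBifunctorMap f g (boxTensorFunctor p q) (ComplexShape.up ℤ) := rfl

end Map

/-! ### §3 The two quasi-isomorphisms -/

section QuasiIso

variable {G : X.Modules} {H : Y.Modules} (R : StrictlyPerfectResolution G) (S : StrictlyPerfectResolution H)

/-- **Rows**: `R.ε ⊠ 𝟙 : R• ⊠ S• ⟶ G[0] ⊠ S•` is a quasi-isomorphism when `p^*` is left exact — every `M ↦ M ⊠ Sʲ` is exact (`Sʲ` finite
locally free), `S•` is bounded, and `R.ε` is a quasi-isomorphism. [cite: StacksProject, Tag 0133] [cite: Hartshorne1977, III Prop. 9.2] -/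
theorem quasiIso_boxTensorComplexMap_ε_left [PreservesFiniteLimits (Scheme.Modules.pullback p)] :
    QuasiIso (boxTensorComplexMap p q R.ε (𝟙 S.P)) := by
  haveI := additive_boxTensorFunctor p q
  haveI := additive_boxTensorFunctor_obj p q
  haveI := additive_boxTensorFunctor_flip p q
  haveI := additive_boxTensorFunctor_flip_obj p q
  exact quasiIso_mapBifunctorMap_id_right (boxTensorFunctor p q) R.ε S.P (-(S.length : ℤ)) 0 fun j => by
    haveI := preservesHomology_boxTensorFunctor_flip_obj p q (S.isFiniteLocallyFree j)
    infer_instance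

/-- **Column**: `𝟙 ⊠ S.ε : G[0] ⊠ S• ⟶ G[0] ⊠ H[0]` is a quasi-isomorphism when `E_G = (N ↦ p^*G ⊗ q^*N)` is exact (the Tor-independence
input) — `G[0] ⊠ –` is `E_G` termwise. [cite: StacksProject, Tag 0FXZ] [cite: Weibel1994, 2.7.1] -/
theorem quasiIso_boxTensorComplexMap_ε_right (G : X.Modules)
    [PreservesFiniteLimits ((boxTensorFunctor p q).obj G)] [PreservesFiniteColimits ((boxTensorFunctor p q).obj G)] :
    QuasiIso (boxTensorComplexMap p q (𝟙 ((CochainComplex.singleFunctor X.Modules 0).obj G)) S.ε) := by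
  haveI := additive_boxTensorFunctor p q
  haveI := additive_boxTensorFunctor_obj p q
  haveI : ((boxTensorFunctor p q).obj G).PreservesHomology := inferInstance
  exact quasiIso_mapBifunctorMap_single₀ (boxTensorFunctor p q) S.ε G inferInstance

end QuasiIso

/-! ### §4 `G[0] ⊠ H[0] ≅ (G ⊠ H)[0]` and the augmentation -/

section Single

variable (G : X.Modules) (H : Y.Modules)

/-- **`G[0] ⊠ H[0] ≅ (G ⊠ H)[0]`**: the box of two one-term complexes is the one-term complex of the box (column isomorphism
`G[0] ⊠ L• ≅ E_G•L•` at `L• = H[0]`, then Mathlib's `E_G•(H[0]) ≅ (E_G H)[0]`). [cite: Weibel1994, 2.7.1 and 1.2.6] -/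
def boxTensorComplexSingleIso :
    boxTensorComplex p q ((CochainComplex.singleFunctor X.Modules 0).obj G) ((CochainComplex.singleFunctor Y.Modules 0).obj H) ≅
      (CochainComplex.singleFunctor Z.Modules 0).obj (boxTensor p q G H) :=
  haveI := additive_boxTensorFunctor p q
  haveI := additive_boxTensorFunctor_obj p q
  columnIso (boxTensorFunctor p q) G ((CochainComplex.singleFunctor Y.Modules 0).obj H) ≪≫
    (singleMapHomologicalComplex ((boxTensorFunctor p q).obj G) (ComplexShape.up ℤ) 0).app H

variable {G H} (R : StrictlyPerfectResolution G) (S : StrictlyPerfectResolution H)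

/-- **The augmentation `R• ⊠ S• ⟶ (G ⊠ H)[0]`**: `(R.ε ⊠ 𝟙) ≫ (𝟙 ⊠ S.ε) ≫ (G[0] ⊠ H[0] ≅ (G ⊠ H)[0])`. [cite: Weibel1994, 2.7.1] -/
def boxTensorComplexAugmentation :
    boxTensorComplex p q R.P S.P ⟶ (CochainComplex.singleFunctor Z.Modules 0).obj (boxTensor p q G H) :=
  boxTensorComplexMap p q R.ε (𝟙 S.P) ≫ boxTensorComplexMap p q (𝟙 _) S.ε ≫ (boxTensorComplexSingleIso p q G H).hom

/-- **The box of two strictly perfect resolutions resolves the box** (Tor-independent case): the augmentation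
`R• ⊠ S• ⟶ (G ⊠ H)[0]` is a quasi-isomorphism. [cite: StacksProject, Tag 0FXX and Lemma 0FXZ] [cite: Weibel1994, 2.7.1–2.7.3] -/
theorem quasiIso_boxTensorComplexAugmentation [PreservesFiniteLimits (Scheme.Modules.pullback p)]
    [PreservesFiniteLimits ((boxTensorFunctor p q).obj G)] [PreservesFiniteColimits ((boxTensorFunctor p q).obj G)] :
    QuasiIso (boxTensorComplexAugmentation p q R S) := by
  haveI := quasiIso_boxTensorComplexMap_ε_left p q R S
  haveI := quasiIso_boxTensorComplexMap_ε_right p q S G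
  rw [boxTensorComplexAugmentation]
  infer_instance

/-- **`Q(R• ⊠ S•) ≅ Q((G ⊠ H)[0])` in the derived category** `D(Mod 𝒪_Z)` (any `HasDerivedCategory` instance), for `p^*` left exact and
`E_G = (boxTensorFunctor p q).obj G` exact: the type of the input `eRes` of the crux-26512 placement theorem
`e₂_of_boxResolutionsIso`. [cite: StacksProject, Tag 0FXX and Lemma 0FXZ] [cite: Weibel1994, 10.4] -/
theorem nonempty_Q_boxTensorComplex_iso_single [HasDerivedCategory.{w} Z.Modules] [PreservesFiniteLimits (Scheme.Modules.pullback p)]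
    [PreservesFiniteLimits ((boxTensorFunctor p q).obj G)] [PreservesFiniteColimits ((boxTensorFunctor p q).obj G)] :
    Nonempty (DerivedCategory.Q.obj (boxTensorComplex p q R.P S.P) ≅
      DerivedCategory.Q.obj ((CochainComplex.singleFunctor Z.Modules 0).obj (boxTensor p q G H))) :=
  haveI := quasiIso_boxTensorComplexAugmentation p q R S
  ⟨asIso (DerivedCategory.Q.map (boxTensorComplexAugmentation p q R S))⟩

end Single

end Literature.AlgebraicGeometry.Modules

end
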